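import Summits.BirchSwinnertonDyer.BirchSwinnertonDyer.Theorems.ClassRecordThreeEulerHalvesAtThreeChebSupplyRoots
import Literature.NumberTheory.GaloisRepresentations.AbsGaloisOuterConj
import Mathlib.FieldTheory.KummerPolynomial
import Mathlib.Algebra.Polynomial.SpecificDegree
import HarnessLib

/-!
# The Kummer generator for the Chebotarev class of `stub_chebotarevSupplyAtThree`
# (crux 19109, line `inert`; STUB-PLAN part C2 (b)): `ã ∈ Gal(ℚ̄/K(ζ, ω))` with `ã c = ω c`

Crux `stmt-BirchSwinnertonDyer-19109` (`EulerHalvesAtThree`), line `inert` (tam3-p1 g18, skeleton r19),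
registered stub `stub_chebotarevSupplyAtThree` (the CHEBOTAREV SUPPLY), STUB-PLAN part NON-EMPTINESS.
Everything happens inside `Γ_ℚ = Gal(ℚ̄/ℚ)` acting on `ℚ̄` (no intermediate field is constructed): with
`e = absEmbedding ℚ K` and `res(Γ_K) = Gal(ℚ̄/e(K))` (`absGaloisRestrict`):

* `exists_mem_range_smul_eq_of_cube` — `Gal(ℚ̄/e(K))` is transitive on the cube roots of a non-cube
  `γ₀ ∈ K` (`X³ − γ₀` irreducible: Mathlib `X_pow_sub_C_irreducible_iff_of_prime`; conjugate roots in
  `K̄` by `minpoly.exists_algEquiv_of_root'`, transported along `absGaloisRestrict`);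
* `exists_mem_range_smul_eq_sq` — some element of `Gal(ℚ̄/e(K))` maps `ω ↦ ω²` when `#𝒪_K^× = 2`
  (then `K` has no primitive cube root of unity: it would be a unit of order `3`);
* `exists_mem_range_smul_eq_omega_mul` — **the Kummer generator**: for a complex conjugation `c₀`
  inverting `e(γ₀)`, `c³ = e(γ₀)`, there is `ã ∈ Gal(ℚ̄/e(K))` fixing `ζ` and `ω` with `ã c = ω c`.
  The proof is an ABELIAN-OBSTRUCTION argument by commutators (the would-be field `K(μ_{3^∞}, c)` is
  never constructed): otherwise the `Gal(ℚ̄/e(K))`-orbit of `c` has ≤ 2 elements, against the three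
  conjugates `c, ωc, ω²c`.

Inputs: p650478 `…ChebSupplyRoots` (action algebra); the tree's `AbsGaloisOuterConj`.  HONEST FRAMING:
part of one registered stub of one line of crux 19109; nothing about BSD for any curve is proved here.

## References

* J. Neukirch, *Algebraic Number Theory* (1999), Ch. IV §1 (infinite Galois theory). [NeukirchANT1999]
* S. Lang, *Algebra*, 3rd ed. (2002), VI §6 Thm. 6.2 (irreducibility of `X^p − a`), VI §8 (Kummer theory). [LangAlgebra2002]

## Mathlib / tree search

Tree: `absEmbedding`, `absClosureEmbedding_absEmbedding`, `absGaloisRestrict_apply_smul`,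
`absClosureEmbedding_bijective`, `absGaloisQuot_eq_one_iff`, `mem_range_absGaloisRestrict_iff_smul_absEmbedding`
(`AbsGaloisOuterConj`); `absoluteGaloisGroup.toAlgEquiv_symm_apply` (`AbsGaloisGroup`); `ChebSupply.*`
(p650478).  Mathlib: `X_pow_sub_C_irreducible_iff_of_prime`,
`Polynomial.irreducible_of_degree_le_three_of_not_isRoot`, `minpoly.eq_of_irreducible_of_monic`,
`minpoly.exists_algEquiv_of_root'`, `orderOf_eq_prime`, `orderOf_dvd_natCard`.
`lean search 'cube root.*absGaloisRestrict|Kummer generator'` (2026-08-28): nothing.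
-/

noncomputable section

set_option autoImplicit false
set_option linter.dupNamespace false

open scoped NumberField
open Field Polynomial Literature.NumberTheory.GaloisRepresentations

namespace Summit.BirchSwinnertonDyer.BirchSwinnertonDyer.Theorems.ChebSupply

variable {K : Type} [Field K] [NumberField K]

/-! ## §1 `K`-automorphisms of `ℚ̄` moving cube roots and `ω` -/

/-- **`Gal(ℚ̄/K)` is transitive on the cube roots of a non-cube `γ₀ ∈ K`**: for `γ₀` not a cube in
`K` and any two cube roots `c, r ∈ ℚ̄` of `e(γ₀)` (`e = absEmbedding ℚ K`), some element of
`res(Γ_K) = Gal(ℚ̄/e(K))` maps `c` to `r` (`X³ − γ₀` is irreducible over `K`, Mathlib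
`X_pow_sub_C_irreducible_iff_of_prime`; conjugate roots, `minpoly.exists_algEquiv_of_root'` in `K̄`,
transported along `absGaloisRestrict`). [folklore] -/
theorem exists_mem_range_smul_eq_of_cube (γ₀ : K) (hγ : ∀ z : K, z ^ 3 ≠ γ₀)
    {c r : AlgebraicClosure ℚ} (hc : c ^ 3 = absEmbedding ℚ K γ₀) (hr : r ^ 3 = absEmbedding ℚ K γ₀) :
    ∃ h ∈ (absGaloisRestrict ℚ K).range, h • c = r := by
  set e := absClosureEmbedding ℚ K with he
  have hp : Irreducible (X ^ 3 - C γ₀ : K[X]) :=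
    (X_pow_sub_C_irreducible_iff_of_prime Nat.prime_three).mpr hγ
  have hmonic : (X ^ 3 - C γ₀ : K[X]).Monic := monic_X_pow_sub_C γ₀ (by norm_num)
  have hroot : ∀ z : AlgebraicClosure ℚ, z ^ 3 = absEmbedding ℚ K γ₀ →
      aeval (e z) (X ^ 3 - C γ₀ : K[X]) = 0 := fun z hz => by
    rw [map_sub, map_pow, aeval_X, aeval_C, ← map_pow, hz, he, absClosureEmbedding_absEmbedding, sub_self]
  have hmin : minpoly K (e c) = X ^ 3 - C γ₀ :=
    (minpoly.eq_of_irreducible_of_monic hp (hroot c hc) hmonic).symm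
  have halg : IsAlgebraic K (e c) := Algebra.IsAlgebraic.isAlgebraic (e c)
  obtain ⟨σ, hσ⟩ := minpoly.exists_algEquiv_of_root' halg (hmin ▸ hroot r hr)
  refine ⟨absGaloisRestrict ℚ K ((absoluteGaloisGroup.toAlgEquiv K).symm σ), ⟨_, rfl⟩, ?_⟩
  apply (absClosureEmbedding_bijective ℚ K).1
  rw [← he, absGaloisRestrict_apply_smul, absoluteGaloisGroup.toAlgEquiv_symm_apply, hσ]

/-- **Some element of `Gal(ℚ̄/K)` maps `ω ↦ ω²`** when `𝒪_K^× = {±1}` (`#𝒪_K^× = 2`: then `K`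
contains no primitive cube root of unity, so `X² + X + 1` is irreducible over `K` and `ω`, `ω²` are
`K`-conjugate). [folklore] -/
theorem exists_mem_range_smul_eq_sq (hunits : Nat.card (𝓞 K)ˣ = 2) {ω : AlgebraicClosure ℚ}
    (hω : IsPrimitiveRoot ω 3) : ∃ h ∈ (absGaloisRestrict ℚ K).range, h • ω = ω ^ 2 := by
  set e := absClosureEmbedding ℚ K with he
  -- `X² + X + 1` has no root in `K`
  have hnoroot : ∀ z : K, z ^ 2 + z + 1 ≠ 0 := by
    intro z hz
    have hz3 : z ^ 3 = 1 := by
      have : z ^ 3 - 1 = (z - 1) * (z ^ 2 + z + 1) := by ring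
      rw [hz, mul_zero, sub_eq_zero] at this
      exact this
    have hz1 : z ≠ 1 := by rintro rfl; norm_num at hz
    have hint : IsIntegral ℤ z := by
      refine ⟨X ^ 3 - 1, (monic_X_pow_sub_C (1 : ℤ) (by norm_num)), ?_⟩
      simp [hz3]
    set u : (𝓞 K)ˣ := ⟨⟨z, hint⟩, ⟨z ^ 2, hint.pow 2⟩, by ext; simp [← pow_succ', hz3], by ext; simp [← pow_succ, hz3]⟩
      with hu
    have hu3 : u ^ 3 = 1 := by ext; simp [hu, hz3]
    have hu1 : u ≠ 1 := by
      intro h; apply hz1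
      have := congrArg (fun v : (𝓞 K)ˣ => ((v : 𝓞 K) : K)) h
      simpa [hu] using this
    have hord : orderOf u = 3 := orderOf_eq_prime hu3 hu1
    have hfin : Finite (𝓞 K)ˣ := Nat.finite_of_card_ne_zero (by rw [hunits]; norm_num)
    have hdvd : 3 ∣ Nat.card (𝓞 K)ˣ := hord ▸ orderOf_dvd_natCard u
    rw [hunits] at hdvd
    omega
  have hnat : (X ^ 2 + X + 1 : K[X]).natDegree = 2 := by compute_degree!
  have hp : Irreducible (X ^ 2 + X + 1 : K[X]) := by
    refine Polynomial.irreducible_of_degree_le_three_of_not_isRoot (by rw [hnat]; decide) fun z hz => ?_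
    apply hnoroot z
    simpa [IsRoot, eval_add, eval_pow, eval_X, eval_one] using hz
  have hmonic : (X ^ 2 + X + 1 : K[X]).Monic := by
    unfold Monic; rw [← coeff_natDegree, hnat]; simp [coeff_add, coeff_X_pow, coeff_X, coeff_one]
  have hω3 : ω ^ 3 = 1 := hω.pow_eq_one
  have hω2 : ω ^ 2 + ω + 1 = 0 := by
    have h1 : ω ≠ 1 := hω.ne_one (by norm_num)
    have : (ω - 1) * (ω ^ 2 + ω + 1) = 0 := by ring_nf; rw [hω3]; ring
    exact (mul_eq_zero.mp this).resolve_left (sub_ne_zero.mpr h1)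
  have hroot : ∀ z : AlgebraicClosure ℚ, z ^ 2 + z + 1 = 0 → aeval (e z) (X ^ 2 + X + 1 : K[X]) = 0 :=
    fun z hz => by
    rw [map_add, map_add, map_pow, aeval_X, map_one, ← map_pow, ← map_one e, ← map_add, ← map_add, hz,
      map_zero]
  have hω4 : (ω ^ 2) ^ 2 + ω ^ 2 + 1 = 0 := by
    have : (ω ^ 2) ^ 2 = ω := by
      rw [← pow_mul]; norm_num; rw [show (4 : ℕ) = 3 + 1 by norm_num, pow_add, hω3, one_mul, pow_one]
    rw [this, add_comm (ω) (ω ^ 2), hω2]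
  have hmin : minpoly K (e ω) = X ^ 2 + X + 1 :=
    (minpoly.eq_of_irreducible_of_monic hp (hroot ω hω2) hmonic).symm
  have halg : IsAlgebraic K (e ω) := Algebra.IsAlgebraic.isAlgebraic (e ω)
  obtain ⟨σ, hσ⟩ := minpoly.exists_algEquiv_of_root' halg (hmin ▸ hroot (ω ^ 2) hω4)
  refine ⟨absGaloisRestrict ℚ K ((absoluteGaloisGroup.toAlgEquiv K).symm σ), ⟨_, rfl⟩, ?_⟩
  apply (absClosureEmbedding_bijective ℚ K).1
  rw [← he, absGaloisRestrict_apply_smul, absoluteGaloisGroup.toAlgEquiv_symm_apply, hσ, map_pow]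

/-! ## §2 The Kummer generator -/

/-- **The Kummer generator `ã`** (STUB-PLAN (C2)(b)): for `K` quadratic with `#𝒪_K^× = 2`, `c₀` a
complex conjugation inverting `e(γ₀)` (`γ₀ ∈ K` a non-cube), `c³ = e(γ₀)`, `ω` a primitive cube root
of unity and `ζ` any primitive root of unity, there is `ã ∈ Gal(ℚ̄/e(K))` fixing `ζ` and `ω` with
`ã c = ω c`.  Proof: otherwise every such element fixes `c`; with `h₀ : ω ↦ ω²`
(`exists_mem_range_smul_eq_sq`) and `g = c₀ h₀` (acts as complex conjugation on `K`, fixes `ω`,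
`g c = ω^m c⁻¹`), the commutator `[g, h]` of any `h ∈ Gal(ℚ̄/e(K))` fixing `ω` lies in `Gal(ℚ̄/e(K))`
(the quotient `Gal(K/ℚ)` kills commutators) and fixes `ζ`, `ω`, hence `c`, so `h c = c`
(`smul_eq_self_of_commutator_smul_eq_self`); elements moving `ω` are `h₀ ·`(fixing `ω`); so the
`Gal(ℚ̄/e(K))`-orbit of `c` is `⊆ {c, h₀ c}` — but it contains `ω c` and `ω² c`
(`exists_mem_range_smul_eq_of_cube`). [folklore] -/
theorem exists_mem_range_smul_eq_omega_mul (h2 : Module.finrank ℚ K = 2) (hunits : Nat.card (𝓞 K)ˣ = 2)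
    {c₀ : absoluteGaloisGroup ℚ} (hc₀ : IsComplexConjugation (Rat.castHom ℝ) c₀)
    {γ₀ : K} (hγ : ∀ z : K, z ^ 3 ≠ γ₀)
    (hc₀γ : c₀ • absEmbedding ℚ K γ₀ = (absEmbedding ℚ K γ₀)⁻¹)
    {ω ζ c : AlgebraicClosure ℚ} (hω : IsPrimitiveRoot ω 3) {n : ℕ} (hζ : IsPrimitiveRoot ζ n) (hn : 0 < n)
    (hc : c ^ 3 = absEmbedding ℚ K γ₀) :
    ∃ a ∈ (absGaloisRestrict ℚ K).range, a • ζ = ζ ∧ a • ω = ω ∧ a • c = ω * c := by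
  haveI : Algebra.IsQuadraticExtension ℚ K := ⟨h2⟩
  set ι := absEmbedding ℚ K with hιdef
  have hγ0 : γ₀ ≠ 0 := fun h => hγ 0 (by rw [h]; ring)
  have hιγ : ι γ₀ ≠ 0 := (map_ne_zero ι).mpr hγ0
  have hc0 : c ≠ 0 := fun h => hιγ (by rw [← hc, h]; ring)
  have hω0 : ω ≠ 0 := hω.ne_zero (by norm_num)
  have hω3 : ω ^ 3 = 1 := hω.pow_eq_one
  have hω1 : ω ≠ 1 := hω.ne_one (by norm_num)
  have hrange := fun g => mem_range_absGaloisRestrict_iff_smul_absEmbedding ℚ K g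
  -- complex conjugation
  have hc₀2 : c₀ * c₀ = 1 := by rw [← pow_two]; exact hc₀.sq_eq_one
  have hinv : ∀ x : AlgebraicClosure ℚ, c₀ • (c₀ • x) = x := fun x => by rw [← mul_smul, hc₀2, one_smul]
  have hc₀ω : c₀ • ω = ω⁻¹ := smul_eq_inv_of_pow_eq_one hc₀ (by norm_num) hω3
  have hc₀c : c₀ • c = c⁻¹ := smul_eq_inv_of_involutive hιγ hc hc₀γ hinv
    (fun u hu => smul_eq_inv_of_pow_eq_one hc₀ (by norm_num) hu)
  -- `h₀`: fixes `K`, `ω ↦ ω²`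
  obtain ⟨h₀, hh₀r, hh₀ω⟩ := exists_mem_range_smul_eq_sq hunits hω
  have hω4 : ω ^ (2 * 2) = ω := by
    rw [show 2 * 2 = 3 + 1 from rfl, pow_succ, hω3, one_mul]
  have hh₀ω' : h₀⁻¹ • ω = ω ^ 2 := by
    rw [inv_smul_eq_iff, smul_pow', hh₀ω, ← pow_mul, hω4]
  -- `g := c₀ h₀`: acts as complex conjugation on `K`, fixes `ω`, `g c = ω^m c⁻¹`
  have hgω : (c₀ * h₀) • ω = ω := by
    rw [mul_smul, hh₀ω, smul_pow', hc₀ω, inv_pow]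
    exact inv_eq_of_mul_eq_one_right (by rw [← pow_succ, hω3])
  have hgγ : (c₀ * h₀) • ι γ₀ = (ι γ₀)⁻¹ := by
    rw [mul_smul, (hrange h₀).mp hh₀r, hc₀γ]
  obtain ⟨m, -, hgc⟩ : ∃ m < 3, (c₀ * h₀) • c = ω ^ m * c⁻¹ :=
    eq_mul_pow_of_pow_three_eq hω (inv_ne_zero hc0) (by rw [← smul_pow', hc, hgγ, inv_pow, hc])
  -- every `a` in the range fixing `ζ`, `ω` acts on `c` by a cube root of unity
  have hcube : ∀ a ∈ (absGaloisRestrict ℚ K).range, ∃ i < 3, a • c = ω ^ i * c := fun a ha =>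
    eq_mul_pow_of_pow_three_eq hω hc0 (by rw [← smul_pow', hc, (hrange a).mp ha])
  by_contra H
  push Not at H
  -- (1) elements of the range fixing `ζ` and `ω` fix `c`
  have hfix : ∀ a ∈ (absGaloisRestrict ℚ K).range, a • ζ = ζ → a • ω = ω → a • c = c := by
    intro a ha haζ haω
    obtain ⟨i, hi, hai⟩ := hcube a ha
    interval_cases i
    · rw [hai, pow_zero, one_mul]
    · exact absurd (by rw [hai, pow_one]) (H a ha haζ haω)
    · exfalso
      refine H (a * a) (Subgroup.mul_mem _ ha ha) (by rw [mul_smul, haζ, haζ])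
        (by rw [mul_smul, haω, haω]) ?_
      rw [mul_smul, hai, smul_mul', smul_pow', haω, hai, ← mul_assoc, ← pow_add,
        show 2 + 2 = 3 + 1 from rfl, pow_succ, hω3, one_mul]
  -- (2) elements of the range fixing `ω` fix `c` (commutator with `g`)
  have hfixω : ∀ h ∈ (absGaloisRestrict ℚ K).range, h • ω = ω → h • c = c := by
    intro h hh hhω
    obtain ⟨i, -, hhi⟩ := hcube h hh
    have hcomm_mem : (c₀ * h₀) * h * (c₀ * h₀)⁻¹ * h⁻¹ ∈ (absGaloisRestrict ℚ K).range := by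
      rw [← absGaloisQuot_eq_one_iff] at hh ⊢
      rw [map_mul, map_mul, map_mul, map_inv, map_inv, hh, inv_one, mul_one, mul_one, mul_inv_cancel]
    have hcommc : ((c₀ * h₀) * h * (c₀ * h₀)⁻¹ * h⁻¹) • c = c :=
      hfix _ hcomm_mem (commutator_smul_eq_self_of_isPrimitiveRoot hζ hn _ _)
        (commutator_smul_eq_self_of_isPrimitiveRoot hω (by norm_num) _ _)
    exact smul_eq_self_of_commutator_smul_eq_self hω hc0 hgc hgω hhi hhω hcommc
  -- (3) every element of the range moves `c` to `c` or to `h₀ c`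
  have horbit : ∀ h ∈ (absGaloisRestrict ℚ K).range, h • c = c ∨ h • c = h₀ • c := by
    intro h hh
    by_cases hhω : h • ω = ω
    · exact Or.inl (hfixω h hh hhω)
    · right
      -- `h ω = ω²`, so `h₀⁻¹ h` fixes `ω`
      obtain ⟨a, ha3, hha⟩ : ∃ a < 3, h • ω = ω ^ a := by
        haveI : NeZero (3 : ℕ) := ⟨by norm_num⟩
        have h1 : (h • ω) ^ 3 = 1 := by rw [← smul_pow', hω3, smul_one]
        obtain ⟨a, ha, hha⟩ := hω.eq_pow_of_pow_eq_one h1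
        exact ⟨a, ha, hha.symm⟩
      interval_cases a
      · rw [pow_zero] at hha
        exact absurd (by simpa using congrArg (fun z => h⁻¹ • z) hha) hω1
      · exact absurd (by rw [hha, pow_one]) hhω
      · have hfix' := hfixω (h₀⁻¹ * h) (Subgroup.mul_mem _ (Subgroup.inv_mem _ hh₀r) hh)
          (by rw [mul_smul, hha, smul_pow', hh₀ω', ← pow_mul, hω4])
        rw [mul_smul, inv_smul_eq_iff] at hfix'
        exact hfix'
  -- (4) but the range moves `c` to `ω c` and to `ω² c`
  obtain ⟨h₁, hh₁r, hh₁⟩ := exists_mem_range_smul_eq_of_cube γ₀ hγ hc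
    (show (ω * c) ^ 3 = absEmbedding ℚ K γ₀ by rw [mul_pow, hω3, one_mul, hc])
  obtain ⟨h₂, hh₂r, hh₂⟩ := exists_mem_range_smul_eq_of_cube γ₀ hγ hc
    (show (ω ^ 2 * c) ^ 3 = absEmbedding ℚ K γ₀ by
      rw [mul_pow, ← pow_mul, show 2 * 3 = 3 * 2 from rfl, pow_mul, hω3, one_pow, one_mul, hc])
  have hω2ne : ω ^ 2 ≠ 1 := fun h2 => by
    have := (hω.pow_eq_one_iff_dvd 2).mp h2
    omega
  have h1c : ω * c ≠ c := fun h1 => hω1 ((mul_left_eq_self₀.mp h1).resolve_right hc0)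
  have h2c : ω ^ 2 * c ≠ c := fun h2 => hω2ne ((mul_left_eq_self₀.mp h2).resolve_right hc0)
  rcases horbit h₁ hh₁r with h1 | h1 <;> rw [hh₁] at h1
  · exact h1c h1
  rcases horbit h₂ hh₂r with h2 | h2 <;> rw [hh₂] at h2
  · exact h2c h2
  rw [← h2] at h1
  have hωω : ω = ω ^ 2 := mul_right_cancel₀ hc0 h1
  exact hω1 (by
    have h3 : ω * ω = ω * 1 := by rw [mul_one, ← pow_two, ← hωω]
    exact mul_left_cancel₀ hω0 h3)

end Summit.BirchSwinnertonDyer.BirchSwinnertonDyer.Theorems.ChebSupply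

end
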